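import Summits.BirchSwinnertonDyer.Rank1Residual.Additive.SemistableTwistTowerThree
import Summits.BirchSwinnertonDyer.Rank1Residual.Additive.PotentiallyOrdinaryThree
import Summits.BirchSwinnertonDyer.Rank1Residual.Additive.TypeGThree
import HarnessLib

/-!
# X4(M) at `p = 3`, analytic rank `0`: the UPPER half of `BSD(E,3)` class-wide WITHOUT the
# Wuthrich-Lemma-20 binder (cell `b2b-bsdres`, team n1011, seat p14, OWNERS row T-b1 kernel piece;
# sequel of `Additive/SemistableTwistTowerThree.lean`)

HONEST FRAMING (cell `b2b-bsdres`, run/shared/lean/b2b/bsd-rank1-residual/, verbatim in every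
file): the goal of the cell is to DELETE the COMBINATION-SHAPED residual classes of the
Birch–Swinnerton-Dyer formula for ALL analytic-rank `≤ 1` elliptic curves over `ℚ` — "full BSD
formula for every rank `≤ 1` curve in class `C`" assembled STRICTLY from published theorems — so
that the rank-`≤ 1` remainder becomes exactly the CONSTRUCTION-SHAPED classes, which are TYPED
(missing-input `Prop`s), NOT attempted. This is not "finishing BSD". Team n1011 (N10 / N11, the
additive block X4 ∧ `p = 3`): research route on the CONSTRUCTION-SHAPED class X4; no claim beyond the
stated classes; the label X4 is UNCHANGED by this file; nothing is booked. Theorems only (no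
definition, no named fact minted; every published input is an explicit named-fact hypothesis).

## What this file proves

Seat additive-p1's gen-7/gen-9 chain on X4(M) ∧ `p = 3` ∧ `r_an = 0` ∧ surj(3)
(`AdditivePotMult/RankZeroChiBranchThree.lean`, `…ThreeFacts.lean`) gives the UPPER half
`ord₃ #Ш(E) ≤ ord₃ #Ш_an(E)` from Delbourgo 1998 Prop. 4, GZK, modularity, a parametrisation datum,
Kato's divisibility on the `ω`-component over `ℚ(ζ_{3^∞})` for the multiplicative twist
`E♭ = E^{(−3)}` — AND Wuthrich 2014 Lemma 20 as a named fact (`hL20`, registry A9), used only for the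
`3`-adic tower of `E♭`. The multiplicative case of Lemma 20 is now a THEOREM of the tree (lit-kato
gen 7, `forall_hasSurjectiveModNGaloisRep_pow_of_multiplicative_of_surj`), packaged for twist models
in `ClassX4M.towerSurj_twist_negThree_of_surj` (sibling file §1). §1 re-assembles the four
`p = 3` theorems of the chain WITHOUT `hL20`:

* `ClassX4M.missingUpperBoundAt_three_rankZero_of_chiBranch_of_surj'` (typed odd-branch input form),
* `ClassX4M.missingUpperBoundAt_three_rankZero_of_surj'` (the input discharged by `hKato`),
  `…bsdp_three_rankZero_of_surj_of_shaAn_unit'`, `…bsdp_three_rankZero_of_surj_of_lower'`,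
  `…missingInputAt_iff_lower_three_rankZero_of_surj'`.

§2 (the `p = 3` forms read off the `j`-INVARIANT alone): at `p = 3` every (G)-ordinary additive pair
has `e = 2` (`semistabilityIndex_eq_two_of_typeG_three`) and (G-ord) ⟺ `j ≠ 0 ∧ ord₃ j = 0`
(`classX4Gord_three_iff_j`), so: `ClassX4.towerSurj_three_of_surj_of_padicValRat_j_le_zero` — **an X4
pair at `3` with `j ≠ 0`, `ord₃ j ≤ 0` and `ρ̄_{E,3}` onto has `ρ̄_{E,3ⁿ}` onto for all `n`**; the
EXOTIC rows (tower fails) have `j = 0 ∨ ord₃ j > 0` (`ClassX4.j_eq_zero_or_padicValRat_j_pos_of_not_towerSurj`,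
cf. Wuthrich's `j ≡ 2·3³ (mod 3⁴)`); and `ClassX4Gord.missingUpperBoundAt_three_of_katoComponent_of_surj`
/ `…bsdp_three…` / `…iff_lower…` — the (G-ord)@3 upper half with NO `e = 2`, NO certificate, NO
Tamagawa, NO Manin premise.

Net effect on the (M)@3 sub-block of N11 (82 103 S-b pairs, rmap-2 GEN 3): the upper half rests on
Delbourgo Prop. 4 + Kato `ω`-component + GZK + modularity ONLY (one named fact fewer; A9 leaves the
X4(M) chain). X4(M) stays CONSTRUCTION-SHAPED (the LOWER half is untouched); nothing booked.

References: Delbourgo 1998 [Delbourgo1998] Prop. 4 (p. 144), Lemma (ii) (p. 139); Wuthrich 2014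
[Wuthrich2014] Lemma 20 (p. 399), Cor. 19 (p. 398); Kato 2004 [Kato2004Asterisque] Thm. 17.4 (3)
(p. 273); Miller 2011 [Miller2011LMS] Def. 1.1.
-/

noncomputable section

open scoped Classical

open WeierstrassCurve Literature.NumberTheory.EllipticCurves
  Literature.NumberTheory.EllipticCurves.ModularForms
  Literature.NumberTheory.EllipticCurves.Rank1Residual
  Literature.NumberTheory.EllipticCurves.Rank1Residual.Typed

/-! ### §1 (M) at `p = 3`, rank `0`: additive-p1's chain with the `hL20` binder removed -/

namespace Summit.BirchSwinnertonDyer.Rank1Residual.AdditivePotMult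

open Additive

variable {W : WeierstrassCurve ℚ} [W.IsElliptic] [W.IsGloballyMinimal]

/-- **X4(M) ∧ `p = 3` ∧ `r_an = 0` ∧ surj(3): `Typed.MissingUpperBoundAt W 3` from the typed
odd-branch input `ChiBranchLeadingTermOddBigImageAt W 3` with NO `ram`, NO Tamagawa AND NO `hL20`
binder** — additive-p1's `ClassX4M.missingUpperBoundAt_three_rankZero_of_chiBranch_of_surj` (gen 7)
with the `3`-adic image of the multiplicative twist model supplied by §1
(`ClassX4M.towerSurj_twist_negThree_of_surj`) instead of Wuthrich's Lemma 20 as a named fact. Other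
inputs as there: Delbourgo 1998 Prop. 4 (`hDel`), GZK, modularity, a parametrisation datum (`hmodD`),
`ClassX4M.not_dvd_tamagawaNumberAt`. X4(M) stays CONSTRUCTION-SHAPED; nothing booked.
[cite: Delbourgo1998, Prop. 4 (p. 144) and Lemma (ii) (p. 139)] [cite: Wuthrich2014, Lemma 20 (p. 399)] -/
theorem ClassX4M.missingUpperBoundAt_three_rankZero_of_chiBranch_of_surj'
    (hDel : Delbourgo1998.prop4_rankZero_pow_dvd_constantCoeff)
    (hGZK : rank_eq_analyticRank_of_analyticRank_le_one) (hmod : hasEntireLFunction_rat)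
    (hmodD : nonempty_modularParametrizationData)
    (hBCodd : ChiBranchLeadingTermOddBigImageAt W 3)
    (hX : ClassX4M W 3) (hr : W.analyticRank = 0) (hsurj : Surj W 3) :
    MissingUpperBoundAt W 3 := by
  obtain ⟨V, iV, iVm, C, hV, hC⟩ := hX.exists_mult_pStar_twist_model
  have hC' : C • V.quadraticTwist (-3 : ℚ) = W := by norm_num at hC; exact hC
  haveI : NeZero (V.conductorNorm ℤ) := ⟨(V.conductorNorm_pos_holds).ne'⟩
  obtain ⟨Dm⟩ := hmodD V
  obtain ⟨ϖ', -, hϖ'⟩ := exists_rat_mul_imaginaryPeriodRat_eq_minusPeriod Dm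
  exact X4RankZeroTwistOdd.missingUpperBoundAt W 3 hDel hGZK hmod hBCodd (by norm_num) hr hX.1 V C
    (by push_cast; exact hC') (Or.inr hV)
    (hX.towerSurj_twist_negThree_of_surj hsurj V C hC') Dm.isNewformOf ϖ' hϖ'
    hX.not_dvd_tamagawaNumberAt

/-- **X4(M) ∧ `r_an(E) = 0` ∧ surj(3) at `p = 3`: the UPPER half `ord₃ #Ш(E) ≤ ord₃ #Ш_an(E)` for
EVERY such curve from Delbourgo 1998 Prop. 4 (`hDel`), GZK, modularity (`hmod`, `hmodD`) and Kato's
divisibility read on the `ω`-component over `ℚ(ζ_{3^∞})` (`hKato`) — additive-p1's gen-9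
`ClassX4M.missingUpperBoundAt_three_rankZero_of_surj` with the `hL20` binder REMOVED** (the
multiplicative case of Wuthrich's Lemma 20 being a theorem of the tree, lit-kato gen 7). NO `ram`,
NO Tamagawa, NO Manin, NO `j`-witness hypothesis. X4(M) stays CONSTRUCTION-SHAPED; nothing booked.
[cite: Delbourgo1998, Prop. 4 (p. 144) and Lemma (ii) (p. 139)] [cite: Wuthrich2014, Lemma 20 (p. 399), Cor. 19 (p. 398)]
[cite: Kato2004Asterisque, Thm. 17.4 (3) (p. 273)] -/
theorem ClassX4M.missingUpperBoundAt_three_rankZero_of_surj'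
    (hDel : Delbourgo1998.prop4_rankZero_pow_dvd_constantCoeff)
    (hGZK : rank_eq_analyticRank_of_analyticRank_le_one) (hmod : hasEntireLFunction_rat)
    (hmodD : nonempty_modularParametrizationData)
    (hKato : Wuthrich2014.kato_minusEigenCharIdeal_dvd_cyclotomicThree_of_surjective)
    (hX : ClassX4M W 3) (hr : W.analyticRank = 0) (hsurj : Surj W 3) : MissingUpperBoundAt W 3 :=
  ClassX4M.missingUpperBoundAt_three_rankZero_of_chiBranch_of_surj' hDel hGZK hmod hmodD
    (chiBranchLeadingTermOddBigImageAt_three hKato W) hX hr hsurj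

/-- **X4(M) ∧ `r_an(E) = 0` ∧ surj(3) ∧ `3 ∤ #Ш_an(E)`: `BSD(E,3)`** — `hL20`-free form of
additive-p1's `ClassX4M.bsdp_three_rankZero_of_surj_of_shaAn_unit`.
[cite: Delbourgo1998, Prop. 4 (p. 144)] [cite: Kato2004Asterisque, Thm. 17.4 (3) (p. 273)]
[cite: Miller2011LMS, §1 and Def. 1.1] -/
theorem ClassX4M.bsdp_three_rankZero_of_surj_of_shaAn_unit'
    (hDel : Delbourgo1998.prop4_rankZero_pow_dvd_constantCoeff)
    (hGZK : rank_eq_analyticRank_of_analyticRank_le_one) (hmod : hasEntireLFunction_rat)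
    (hmodD : nonempty_modularParametrizationData)
    (hKato : Wuthrich2014.kato_minusEigenCharIdeal_dvd_cyclotomicThree_of_surjective)
    (hX : ClassX4M W 3) (hr : W.analyticRank = 0) (hsurj : Surj W 3)
    {q : ℚ} (hq : shaAn W = (q : ℂ)) (hv : padicValRat 3 q = 0) : BSDp W 3 :=
  haveI : Fact (Nat.Prime 3) := ⟨Nat.prime_three⟩
  bsdp_of_missingPPartAt W 3 hGZK (by rw [hr]; exact zero_le_one)
    (missingPPartAt_of_upper_of_shaAn_unit W 3
      (ClassX4M.missingUpperBoundAt_three_rankZero_of_surj' hDel hGZK hmod hmodD hKato hX hr hsurj)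
      hq hv)

/-- **X4(M) ∧ `r_an(E) = 0` ∧ surj(3): `BSD(E,3)` from the LOWER half** (the `3 ∣ #Ш_an` rows) —
`hL20`-free form of additive-p1's `ClassX4M.bsdp_three_rankZero_of_surj_of_lower`.
[cite: Delbourgo1998, Prop. 4 (p. 144)] [cite: Kato2004Asterisque, Thm. 17.4 (3) (p. 273)]
[cite: Miller2011LMS, §1 and Def. 1.1] -/
theorem ClassX4M.bsdp_three_rankZero_of_surj_of_lower'
    (hDel : Delbourgo1998.prop4_rankZero_pow_dvd_constantCoeff)
    (hGZK : rank_eq_analyticRank_of_analyticRank_le_one) (hmod : hasEntireLFunction_rat)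
    (hmodD : nonempty_modularParametrizationData)
    (hKato : Wuthrich2014.kato_minusEigenCharIdeal_dvd_cyclotomicThree_of_surjective)
    (hX : ClassX4M W 3) (hr : W.analyticRank = 0) (hsurj : Surj W 3)
    (hlow : MissingLowerBoundAt W 3) : BSDp W 3 :=
  haveI : Fact (Nat.Prime 3) := ⟨Nat.prime_three⟩
  bsdp_of_missingPPartAt W 3 hGZK (by rw [hr]; exact zero_le_one)
    (missingPPartAt_of_lower_of_upper W 3 hlow
      (ClassX4M.missingUpperBoundAt_three_rankZero_of_surj' hDel hGZK hmod hmodD hKato hX hr hsurj))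

/-- **X4(M) ∧ `r_an(E) = 0` ∧ surj(3) at `p = 3`: what remains of X4♯ is EXACTLY the lower half**
(`Typed.X4.MissingInputAt W 3 ⟺ MissingLowerBoundAt W 3`) — `hL20`-free form.
[cite: Delbourgo1998, Prop. 4 (p. 144)] [cite: Kato2004Asterisque, Thm. 17.4 (3) (p. 273)] -/
theorem ClassX4M.missingInputAt_iff_lower_three_rankZero_of_surj'
    (hDel : Delbourgo1998.prop4_rankZero_pow_dvd_constantCoeff)
    (hGZK : rank_eq_analyticRank_of_analyticRank_le_one) (hmod : hasEntireLFunction_rat)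
    (hmodD : nonempty_modularParametrizationData)
    (hKato : Wuthrich2014.kato_minusEigenCharIdeal_dvd_cyclotomicThree_of_surjective)
    (hX : ClassX4M W 3) (hr : W.analyticRank = 0) (hsurj : Surj W 3) :
    X4.MissingInputAt W 3 ↔ MissingLowerBoundAt W 3 :=
  ⟨fun h ↦ (lower_and_upper_of_missingPPartAt W 3 h).1, fun h ↦
    missingPPartAt_of_lower_of_upper W 3 h
      (ClassX4M.missingUpperBoundAt_three_rankZero_of_surj' hDel hGZK hmod hmodD hKato hX hr hsurj)⟩

end Summit.BirchSwinnertonDyer.Rank1Residual.AdditivePotMult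

/-! ### §2 `p = 3`: the tower and the (G-ord) upper half read off the `j`-invariant alone -/

namespace Summit.BirchSwinnertonDyer.Rank1Residual.Additive

variable {W : WeierstrassCurve ℚ} [W.IsElliptic] [W.IsGloballyMinimal]

/-- **X4♯(G-ord) at `p = 3`: the tower from surj(3), no defect hypothesis** — at `3` every
(G)-ordinary additive pair is Kodaira `I₀*` (`semistabilityIndex_eq_two_of_typeG_three`).
[cite: Wuthrich2014, Lemma 20 (p. 399)] [cite: Kato2004Asterisque, (12.5.2) in Thm. 12.5 (4) (p. 222)] -/
theorem ClassX4Gord.towerSurj_three_of_surj [Fact (Nat.Prime 3)] (hX : ClassX4Gord W 3)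
    (hsurj : Surj W 3) (n : ℕ) : W.HasSurjectiveModNGaloisRep (3 ^ n : ℕ) :=
  ClassX4Gord.towerSurj_of_surj hX
    (semistabilityIndex_eq_two_of_typeG_three W hX.typeGOrd.typeG hX.addv.2) hsurj n

/-- **The `3`-adic tower of an X4 pair at `3` is decided by `j` and `ρ̄_{E,3}`**: if `j(E) ≠ 0`,
`ord₃ j(E) ≤ 0` (potentially multiplicative, or potentially good ORDINARY = `j` a `3`-adic unit,
`classX4Gord_three_iff_j`) and `ρ̄_{E,3}` is onto, then `ρ̄_{E,3ⁿ}` is onto for every `n` — NO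
(ram), NO `j`-witness, NO mod-`9` certificate. [cite: Wuthrich2014, Lemma 20 (p. 399)]
[cite: SerreAbelianLadic1968, Ch. IV §3.4, Lemma 3 (IV-23)] -/
theorem ClassX4.towerSurj_three_of_surj_of_padicValRat_j_le_zero [Fact (Nat.Prime 3)]
    (hX : ClassX4 W 3) (hj0 : W.j ≠ 0) (hj : padicValRat 3 W.j ≤ 0) (hsurj : Surj W 3) (n : ℕ) :
    W.HasSurjectiveModNGaloisRep (3 ^ n : ℕ) := by
  rcases hj.lt_or_eq with hneg | hzero
  · exact AdditivePotMult.ClassX4M.towerSurj_of_surj ⟨hX, hX.2.1, hneg⟩ hsurj n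
  · exact ClassX4Gord.towerSurj_three_of_surj ((classX4Gord_three_iff_j W).mpr ⟨hX, hj0, hzero⟩)
      hsurj n

/-- **The EXOTIC rows sit at `j = 0` or `ord₃ j > 0`**: an X4 pair at `3` with `ρ̄_{E,3}` onto
whose tower FAILS has `j(E) = 0` or `ord₃ j(E) > 0` (potentially good SUPERSINGULAR or wild) —
the kernel form of Wuthrich's observation that the Elkies curves have `j ≡ 2·3³ (mod 3⁴)`.
[cite: Wuthrich2014, Lemma 20 (p. 399)] -/
theorem ClassX4.j_eq_zero_or_padicValRat_j_pos_of_not_towerSurj [Fact (Nat.Prime 3)]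
    (hX : ClassX4 W 3) (hsurj : Surj W 3) (hnot : ¬ ∀ n : ℕ, W.HasSurjectiveModNGaloisRep (3 ^ n : ℕ)) :
    W.j = 0 ∨ 0 < padicValRat 3 W.j := by
  by_contra h
  rw [not_or, not_lt] at h
  exact hnot (ClassX4.towerSurj_three_of_surj_of_padicValRat_j_le_zero hX h.1 h.2 hsurj)

/-- **X4♯(G-ord) ∧ `p = 3` ∧ `r_an = 0` ∧ surj(3): the UPPER half `ord₃ #Ш(E) ≤ ord₃ #Ш_an(E)`
from named facts alone — NO defect, NO certificate, NO Tamagawa, NO Manin premise** (Kato 2004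
Thm. 17.4 (3) component reading `hK`, Delbourgo 1998 Prop. 4 `hDel`, GZK, modularity). The
(G-ord)@3 sub-block of N11 (16 517 S-b pairs, rmap-2 GEN 2) thus carries exactly ONE missing input,
the LOWER half. [cite: Kato2004Asterisque, Thm. 17.4 (3) (p. 273)] [cite: Delbourgo1998, Prop. 4 (p. 144)]
[cite: Miller2011LMS, Def. 1.1] -/
theorem ClassX4Gord.missingUpperBoundAt_three_of_katoComponent_of_surj [Fact (Nat.Prime 3)]
    (hK : Kato2004.charIdeal_dvd_padicLFunctionBranch_component_of_surjective)
    (hDel : Delbourgo1998.prop4_rankZero_pow_dvd_constantCoeff)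
    (hGZK : rank_eq_analyticRank_of_analyticRank_le_one) (hmod : hasEntireLFunction_rat)
    (hmodD : nonempty_modularParametrizationData)
    (hX : ClassX4Gord W 3) (hr : W.analyticRank = 0) (hsurj : Surj W 3) : MissingUpperBoundAt W 3 :=
  ClassX4Gord.missingUpperBoundAt_rankZero_of_katoComponent_of_surj hK hDel hGZK hmod hmodD hX
    (semistabilityIndex_eq_two_of_typeG_three W hX.typeGOrd.typeG hX.addv.2) hr hsurj

/-- **`BSD(E,3)` on X4♯(G-ord) ∧ `p = 3` ∧ `r_an = 0` ∧ surj(3) ∧ `3 ∤ #Ш_an(E)`** — whatever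
`∏ c_ℓ`, no Manin datum, no certificate. [cite: Kato2004Asterisque, Thm. 17.4 (3) (p. 273)]
[cite: Delbourgo1998, Prop. 4 (p. 144)] [cite: Miller2011LMS, §1 and Def. 1.1] -/
theorem ClassX4Gord.bsdp_three_of_katoComponent_of_surj_of_shaAn_unit [Fact (Nat.Prime 3)]
    (hK : Kato2004.charIdeal_dvd_padicLFunctionBranch_component_of_surjective)
    (hDel : Delbourgo1998.prop4_rankZero_pow_dvd_constantCoeff)
    (hGZK : rank_eq_analyticRank_of_analyticRank_le_one) (hmod : hasEntireLFunction_rat)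
    (hmodD : nonempty_modularParametrizationData)
    (hX : ClassX4Gord W 3) (hr : W.analyticRank = 0) (hsurj : Surj W 3)
    {q : ℚ} (hq : shaAn W = (q : ℂ)) (hv : padicValRat 3 q = 0) : BSDp W 3 :=
  ClassX4Gord.bsdp_rankZero_of_katoComponent_of_surj_of_shaAn_unit hK hDel hGZK hmod hmodD hX
    (semistabilityIndex_eq_two_of_typeG_three W hX.typeGOrd.typeG hX.addv.2) hr hsurj hq hv

/-- **X4♯(G-ord) ∧ `p = 3` ∧ `r_an = 0` ∧ surj(3): what remains of X4♯ is EXACTLY the lower half**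
(`Typed.X4.MissingInputAt W 3 ↔ MissingLowerBoundAt W 3`), no certificate.
[cite: Kato2004Asterisque, Thm. 17.4 (3) (p. 273)] [cite: Delbourgo1998, Prop. 4 (p. 144)] -/
theorem ClassX4Gord.missingInputAt_iff_lower_three_of_katoComponent_of_surj [Fact (Nat.Prime 3)]
    (hK : Kato2004.charIdeal_dvd_padicLFunctionBranch_component_of_surjective)
    (hDel : Delbourgo1998.prop4_rankZero_pow_dvd_constantCoeff)
    (hGZK : rank_eq_analyticRank_of_analyticRank_le_one) (hmod : hasEntireLFunction_rat)
    (hmodD : nonempty_modularParametrizationData)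
    (hX : ClassX4Gord W 3) (hr : W.analyticRank = 0) (hsurj : Surj W 3) :
    X4.MissingInputAt W 3 ↔ MissingLowerBoundAt W 3 :=
  ClassX4Gord.missingInputAt_iff_lower_rankZero_of_katoComponent_of_surj hK hDel hGZK hmod hmodD hX
    (semistabilityIndex_eq_two_of_typeG_three W hX.typeGOrd.typeG hX.addv.2) hr hsurj

/-- **`BSD(E,3)` on X4♯(G-ord) ∧ `p = 3` ∧ `r_an = 0` ∧ surj(3) from the LOWER half** (the
`3 ∣ #Ш_an` rows), no certificate. [cite: Kato2004Asterisque, Thm. 17.4 (3) (p. 273)]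
[cite: Delbourgo1998, Prop. 4 (p. 144)] [cite: Miller2011LMS, §1 and Def. 1.1] -/
theorem ClassX4Gord.bsdp_three_of_katoComponent_of_surj_of_lower [Fact (Nat.Prime 3)]
    (hK : Kato2004.charIdeal_dvd_padicLFunctionBranch_component_of_surjective)
    (hDel : Delbourgo1998.prop4_rankZero_pow_dvd_constantCoeff)
    (hGZK : rank_eq_analyticRank_of_analyticRank_le_one) (hmod : hasEntireLFunction_rat)
    (hmodD : nonempty_modularParametrizationData)
    (hX : ClassX4Gord W 3) (hr : W.analyticRank = 0) (hsurj : Surj W 3)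
    (hlow : MissingLowerBoundAt W 3) : BSDp W 3 :=
  ClassX4Gord.bsdp_rankZero_of_katoComponent_of_surj_of_lower hK hDel hGZK hmod hmodD hX
    (semistabilityIndex_eq_two_of_typeG_three W hX.typeGOrd.typeG hX.addv.2) hr hsurj hlow

/-- **The semistable-twist locus of N11 in one statement**: for an X4 pair at `p = 3` with
`r_an = 0`, `ρ̄_{E,3}` onto, `j ≠ 0` and `ord₃ j ≤ 0` — (M) by Delbourgo Prop. 4 + Kato's
`ω`-component (`hDel`, `hKato`), (G-ord) by Kato's component reading (`hK`) + Delbourgo Prop. 4 —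
the UPPER half `ord₃ #Ш(E) ≤ ord₃ #Ш_an(E)` holds with NO certificate, NO Tamagawa, NO Manin and NO
`hL20` premise. [cite: Kato2004Asterisque, Thm. 17.4 (3) (p. 273)] [cite: Delbourgo1998, Prop. 4 (p. 144)]
[cite: Wuthrich2014, Cor. 19 (p. 398)] [cite: Miller2011LMS, Def. 1.1] -/
theorem ClassX4.missingUpperBoundAt_three_of_padicValRat_j_le_zero_of_surj [Fact (Nat.Prime 3)]
    (hK : Kato2004.charIdeal_dvd_padicLFunctionBranch_component_of_surjective)
    (hDel : Delbourgo1998.prop4_rankZero_pow_dvd_constantCoeff)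
    (hGZK : rank_eq_analyticRank_of_analyticRank_le_one) (hmod : hasEntireLFunction_rat)
    (hmodD : nonempty_modularParametrizationData)
    (hKato : Wuthrich2014.kato_minusEigenCharIdeal_dvd_cyclotomicThree_of_surjective)
    (hX : ClassX4 W 3) (hr : W.analyticRank = 0) (hsurj : Surj W 3) (hj0 : W.j ≠ 0)
    (hj : padicValRat 3 W.j ≤ 0) : MissingUpperBoundAt W 3 := by
  rcases hj.lt_or_eq with hneg | hzero
  · exact AdditivePotMult.ClassX4M.missingUpperBoundAt_three_rankZero_of_surj' hDel hGZK hmod hmodD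
      hKato ⟨hX, hX.2.1, hneg⟩ hr hsurj
  · exact ClassX4Gord.missingUpperBoundAt_three_of_katoComponent_of_surj hK hDel hGZK hmod hmodD
      ((classX4Gord_three_iff_j W).mpr ⟨hX, hj0, hzero⟩) hr hsurj

/-- **`BSD(E,3)` on the semistable-twist locus of N11 with `3 ∤ #Ш_an(E)`**: X4 ∧ `p = 3` ∧
`r_an = 0` ∧ surj(3) ∧ `j ≠ 0` ∧ `ord₃ j ≤ 0` ∧ `ord₃ #Ш_an = 0` ⟹ `BSDp W 3` — no certificate, no
Tamagawa, no Manin, no `hL20`. [cite: Kato2004Asterisque, Thm. 17.4 (3) (p. 273)]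
[cite: Delbourgo1998, Prop. 4 (p. 144)] [cite: Miller2011LMS, §1 and Def. 1.1] -/
theorem ClassX4.bsdp_three_of_padicValRat_j_le_zero_of_surj_of_shaAn_unit [Fact (Nat.Prime 3)]
    (hK : Kato2004.charIdeal_dvd_padicLFunctionBranch_component_of_surjective)
    (hDel : Delbourgo1998.prop4_rankZero_pow_dvd_constantCoeff)
    (hGZK : rank_eq_analyticRank_of_analyticRank_le_one) (hmod : hasEntireLFunction_rat)
    (hmodD : nonempty_modularParametrizationData)
    (hKato : Wuthrich2014.kato_minusEigenCharIdeal_dvd_cyclotomicThree_of_surjective)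
    (hX : ClassX4 W 3) (hr : W.analyticRank = 0) (hsurj : Surj W 3) (hj0 : W.j ≠ 0)
    (hj : padicValRat 3 W.j ≤ 0) {q : ℚ} (hq : shaAn W = (q : ℂ)) (hv : padicValRat 3 q = 0) :
    BSDp W 3 :=
  bsdp_of_missingPPartAt W 3 hGZK (by rw [hr]; exact zero_le_one)
    (missingPPartAt_of_upper_of_shaAn_unit W 3
      (ClassX4.missingUpperBoundAt_three_of_padicValRat_j_le_zero_of_surj hK hDel hGZK hmod hmodD hKato
        hX hr hsurj hj0 hj) hq hv)

/-- **On the semistable-twist locus of N11 what remains is EXACTLY the lower half**: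
`Typed.X4.MissingInputAt W 3 ↔ MissingLowerBoundAt W 3` for X4 ∧ `p = 3` ∧ `r_an = 0` ∧ surj(3) ∧
`j ≠ 0` ∧ `ord₃ j ≤ 0`. [cite: Kato2004Asterisque, Thm. 17.4 (3) (p. 273)] [cite: Delbourgo1998, Prop. 4 (p. 144)] -/
theorem ClassX4.missingInputAt_iff_lower_three_of_padicValRat_j_le_zero_of_surj [Fact (Nat.Prime 3)]
    (hK : Kato2004.charIdeal_dvd_padicLFunctionBranch_component_of_surjective)
    (hDel : Delbourgo1998.prop4_rankZero_pow_dvd_constantCoeff)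
    (hGZK : rank_eq_analyticRank_of_analyticRank_le_one) (hmod : hasEntireLFunction_rat)
    (hmodD : nonempty_modularParametrizationData)
    (hKato : Wuthrich2014.kato_minusEigenCharIdeal_dvd_cyclotomicThree_of_surjective)
    (hX : ClassX4 W 3) (hr : W.analyticRank = 0) (hsurj : Surj W 3) (hj0 : W.j ≠ 0)
    (hj : padicValRat 3 W.j ≤ 0) : X4.MissingInputAt W 3 ↔ MissingLowerBoundAt W 3 :=
  ⟨fun h ↦ (lower_and_upper_of_missingPPartAt W 3 h).1, fun h ↦
    missingPPartAt_of_lower_of_upper W 3 h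
      (ClassX4.missingUpperBoundAt_three_of_padicValRat_j_le_zero_of_surj hK hDel hGZK hmod hmodD hKato
        hX hr hsurj hj0 hj)⟩

end Summit.BirchSwinnertonDyer.Rank1Residual.Additive

end
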